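import Summits.NavierStokesRegularity.NavierStokesRegularity.Theorems.SqueezeCycleRecurrentLiouvilleOrbitContinuous
import Summits.NavierStokesRegularity.NavierStokesRegularity.Theorems.RecurrentProfilesRecurrentReductionOrbit
import HarnessLib

/-!
# Crux `RecurrentLiouville` (stmt-NavierStokesRegularity-1589), line `Sketch` (v7) — stub `stub_frOrbitModulus`:
# a class-uniform modulus of continuity of the scaling orbit in `L³(Q(0,1))`

Theorems-only file (no definitions, no named facts).  For every bound `M < ∞` and every `ε > 0`
there is `r > 0` such that EVERY suitable weak solution `(u, p)` of Navier–Stokes (`ν = 1`,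
`f = 0`) on the backward slab `ℝ³ × ℝ₋ = (-∞, 0) × ℝ³` with a weak spatial gradient `G` and
Albritton–Barker quantity `𝐈(u, p, G) ≤ M` satisfies `‖u_{e^σ} − u‖_{L³(Q(0,1))} ≤ ε` for all
`|σ| ≤ r` (`stub_frOrbitModulus`); here `u_c(t, x) = c u(c² t, c x)` (`nsRescale c u`) is the
Navier–Stokes scaling orbit and `Q(0, R) = ]-R², 0[ × B(0, R)`.  No rate hypothesis is used: this
is "equicontinuity from compactness" of the class.

Proof: if not, there are class members `u_k` and log-scales `|σ_k| ≤ 1/(k+1)` with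
`‖(u_k)_{e^{σ_k}} − u_k‖_{L³(Q(0,1))} > ε`.  By the tree's engine `slab_typeI_compactness`
(Albritton–Barker 2019, Lemma 2.2 on the exhausting balls, `𝐈 ≤ 4M` for the limit) a subsequence
`u_{ψ j}` converges in `L³(Q(0, R))`, for every `R > 0`, to a slab profile `u'` lying in every
`L³(Q(0, R))` (`memLp_three_of_slabProfile`), whose scaling orbit is therefore continuous in
`L³(Q(0, 1))` (`stub_rlOrbitContinuous`).  With `c_j = e^{σ_{ψ j}} → 1`, split on `Q(0, 1)`
`(u_k)_c − u_k = ((u_k)_c − u'_c) + (u'_c − u') + (u' − u_k)` (`k = ψ j`, `c = c_j`,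
`frOrbitModulus_split`): the first term is `c (c⁵)^{-1/3} ‖u_k − u'‖_{L³(Q(0, c))} ≤
2·32^{1/3} ‖u_k − u'‖_{L³(Q(0, 2))}` by the exact scaling law (`eLpNorm_zoom_sub_zoom`), so all
three terms tend to zero along `j` — a contradiction.

## References

* D. Albritton, T. Barker, J. Math. Fluid Mech. 21 (2019), no. 43 = arXiv:1811.00502, Lemma 2.2,
  §3. [AlbrittonBarker2019]
* W. Rudin, *Real and Complex Analysis*, 3rd ed., Thm. 9.5 (continuity of translation in `L^p`).
  [folklore]
-/

noncomputable section

-- the sub-problem namespace repeats the summit name (D-0017 layout `Summit.<S>.<P>.Theorems`)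
set_option linter.dupNamespace false

namespace Summit.NavierStokesRegularity.NavierStokesRegularity.Theorems

open MeasureTheory Set Function Filter Topology TopologicalSpace Metric
open Literature.Analysis Literature.Analysis.FluidPDE
open scoped NNReal ENNReal

/-- **Three-term split of an orbit increment against a comparison field.**  For `c ∈ (1/2, 2)`,
a field `w` lying in `L³(Q(0, R))` for every `R > 0`, and a field `v` with `v`, `v_c` measurable on
`Q(0, 1)`:
`‖v_c − v‖_{L³(Q(0,1))} ≤ 2·32^{1/3} ‖v − w‖_{L³(Q(0,2))} + ‖w_c − w‖_{L³(Q(0,1))} + ‖v − w‖_{L³(Q(0,1))}`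
(Minkowski, the exact scaling law `‖v_c − w_c‖_{L³(Q(0,1))} = c (c⁵)^{-1/3} ‖v − w‖_{L³(Q(0,c))}`,
`c (c⁵)^{-1/3} ≤ 2·32^{1/3}` and `Q(0, c) ⊆ Q(0, 2)`). [folklore] -/
theorem frOrbitModulus_split {v w : ℝ → EuclideanSpace ℝ (Fin 3) → EuclideanSpace ℝ (Fin 3)}
    {c : ℝ} (hc : c ∈ Ioo (1 / 2 : ℝ) 2)
    (hvm : AEStronglyMeasurable (uncurry v)
      (volume.restrict (parabolicCylinder 1 (0 : ℝ × EuclideanSpace ℝ (Fin 3)))))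
    (hvcm : AEStronglyMeasurable (uncurry (nsRescale c v))
      (volume.restrict (parabolicCylinder 1 (0 : ℝ × EuclideanSpace ℝ (Fin 3)))))
    (hw : ∀ R : ℝ, 0 < R → MemLp (uncurry w) 3
      (volume.restrict (parabolicCylinder R (0 : ℝ × EuclideanSpace ℝ (Fin 3))))) :
    eLpNorm (uncurry (nsRescale c v) - uncurry v) 3
        (volume.restrict (parabolicCylinder 1 (0 : ℝ × EuclideanSpace ℝ (Fin 3)))) ≤
      ENNReal.ofReal 2 * ENNReal.ofReal 32 ^ (1 / (3 : ℝ≥0∞).toReal) *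
          eLpNorm (uncurry v - uncurry w) 3
            (volume.restrict (parabolicCylinder 2 (0 : ℝ × EuclideanSpace ℝ (Fin 3)))) +
        eLpNorm (uncurry (nsRescale c w) - uncurry w) 3
          (volume.restrict (parabolicCylinder 1 (0 : ℝ × EuclideanSpace ℝ (Fin 3)))) +
        eLpNorm (uncurry v - uncurry w) 3
          (volume.restrict (parabolicCylinder 1 (0 : ℝ × EuclideanSpace ℝ (Fin 3)))) := by
  have hc0 : 0 < c := by linarith [hc.1]
  -- measurability of `w` and `w_c` on `Q(0, 1)`
  have hwm : AEStronglyMeasurable (uncurry w)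
      (volume.restrict (parabolicCylinder 1 (0 : ℝ × EuclideanSpace ℝ (Fin 3)))) := (hw 1 one_pos).1
  have hwcm : AEStronglyMeasurable (uncurry (nsRescale c w))
      (volume.restrict (parabolicCylinder 1 (0 : ℝ × EuclideanSpace ℝ (Fin 3)))) := by
    rw [nsRescale_eq_zoom c w]
    exact (memLp_three_zoom hc0 (hw (c * 1) (by positivity))).1
  -- Term 1: the exact scaling law, the bound on its constant, and `Q(0, c) ⊆ Q(0, 2)`
  have hT1 : eLpNorm (uncurry (nsRescale c v) - uncurry (nsRescale c w)) 3
      (volume.restrict (parabolicCylinder 1 (0 : ℝ × EuclideanSpace ℝ (Fin 3)))) ≤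
      ENNReal.ofReal 2 * ENNReal.ofReal 32 ^ (1 / (3 : ℝ≥0∞).toReal) *
        eLpNorm (uncurry v - uncurry w) 3
          (volume.restrict (parabolicCylinder 2 (0 : ℝ × EuclideanSpace ℝ (Fin 3)))) := by
    rw [nsRescale_eq_zoom c v, nsRescale_eq_zoom c w, eLpNorm_zoom_sub_zoom v w hc0 1]
    refine mul_le_mul' (rlOrbitContinuous_zoomConst_le hc) (eLpNorm_mono_measure _ ?_)
    exact Measure.restrict_mono
      (SuitableCompactness.parabolicCylinder_zero_mono (by positivity) (by linarith [hc.2])) le_rfl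
  -- the split
  calc eLpNorm (uncurry (nsRescale c v) - uncurry v) 3
        (volume.restrict (parabolicCylinder 1 (0 : ℝ × EuclideanSpace ℝ (Fin 3))))
      = eLpNorm ((uncurry (nsRescale c v) - uncurry (nsRescale c w)) +
          ((uncurry (nsRescale c w) - uncurry w) + (uncurry w - uncurry v))) 3
          (volume.restrict (parabolicCylinder 1 (0 : ℝ × EuclideanSpace ℝ (Fin 3)))) := by
        rw [sub_add_sub_cancel, sub_add_sub_cancel]
    _ ≤ eLpNorm (uncurry (nsRescale c v) - uncurry (nsRescale c w)) 3
          (volume.restrict (parabolicCylinder 1 (0 : ℝ × EuclideanSpace ℝ (Fin 3)))) +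
        eLpNorm ((uncurry (nsRescale c w) - uncurry w) + (uncurry w - uncurry v)) 3
          (volume.restrict (parabolicCylinder 1 (0 : ℝ × EuclideanSpace ℝ (Fin 3)))) :=
        eLpNorm_add_le (hvcm.sub hwcm) ((hwcm.sub hwm).add (hwm.sub hvm)) (by norm_num)
    _ ≤ eLpNorm (uncurry (nsRescale c v) - uncurry (nsRescale c w)) 3
          (volume.restrict (parabolicCylinder 1 (0 : ℝ × EuclideanSpace ℝ (Fin 3)))) +
        (eLpNorm (uncurry (nsRescale c w) - uncurry w) 3
          (volume.restrict (parabolicCylinder 1 (0 : ℝ × EuclideanSpace ℝ (Fin 3)))) +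
          eLpNorm (uncurry w - uncurry v) 3
          (volume.restrict (parabolicCylinder 1 (0 : ℝ × EuclideanSpace ℝ (Fin 3))))) :=
        add_le_add le_rfl (eLpNorm_add_le (hwcm.sub hwm) (hwm.sub hvm) (by norm_num))
    _ ≤ ENNReal.ofReal 2 * ENNReal.ofReal 32 ^ (1 / (3 : ℝ≥0∞).toReal) *
          eLpNorm (uncurry v - uncurry w) 3
            (volume.restrict (parabolicCylinder 2 (0 : ℝ × EuclideanSpace ℝ (Fin 3)))) +
        (eLpNorm (uncurry (nsRescale c w) - uncurry w) 3
          (volume.restrict (parabolicCylinder 1 (0 : ℝ × EuclideanSpace ℝ (Fin 3)))) +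
          eLpNorm (uncurry v - uncurry w) 3
          (volume.restrict (parabolicCylinder 1 (0 : ℝ × EuclideanSpace ℝ (Fin 3))))) :=
        add_le_add hT1 (add_le_add le_rfl (eLpNorm_sub_comm _ _ _ _).le)
    _ = _ := (add_assoc _ _ _).symm

/-- **S1 — class-uniform modulus of the scaling orbit in `L³(Q(0,1))`.**  For every bound `M < ⊤`
and `ε > 0` there is `r > 0` such that every suitable weak solution `(u,p)` on `ℝ³ × ℝ₋` with a weak
gradient and `𝐈 ≤ M` satisfies `‖u_{e^σ} − u‖_{L³(Q(0,1))} ≤ ε` whenever `|σ| ≤ r`: contradiction,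
A–B compactness of the class (`slab_typeI_compactness`), orbit continuity of the limit
(`stub_rlOrbitContinuous`) and the exact scaling law of `L³` distances (`eLpNorm_zoom_sub_zoom`,
through `frOrbitModulus_split`). [cite: AlbrittonBarker2019, Lemma 2.2] -/
theorem stub_frOrbitModulus :
    ∀ (M : ℝ≥0∞), M < ⊤ → ∀ ε : ℝ, 0 < ε → ∃ r : ℝ, 0 < r ∧
      ∀ (u : ℝ → EuclideanSpace ℝ (Fin 3) → EuclideanSpace ℝ (Fin 3))
        (p : ℝ → EuclideanSpace ℝ (Fin 3) → ℝ)
        (G : ℝ → EuclideanSpace ℝ (Fin 3) → EuclideanSpace ℝ (Fin 3) →L[ℝ] EuclideanSpace ℝ (Fin 3)),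
        IsSuitableWeakSolutionOn (slab (EuclideanSpace ℝ (Fin 3)) (Iio 0) isOpen_Iio) 1 0 u p →
        HasWeakSpatialGradientOn (slab (EuclideanSpace ℝ (Fin 3)) (Iio 0) isOpen_Iio) u G →
        typeIBound (Iio (0 : ℝ) ×ˢ univ) u p G ≤ M →
        ∀ σ : ℝ, |σ| ≤ r →
          eLpNorm (uncurry (nsRescale (Real.exp σ) u) - uncurry u) 3
            (volume.restrict (parabolicCylinder 1 (0 : ℝ × EuclideanSpace ℝ (Fin 3)))) ≤
              ENNReal.ofReal ε := by
  intro M hM ε hε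
  by_contra hcon
  push Not at hcon
  have hδk : ∀ k : ℕ, (0 : ℝ) < 1 / ((k : ℝ) + 1) := fun k => by positivity
  choose u p G hsw hwg hbd σ hσ hlt using fun k : ℕ => hcon _ (hδk k)
  -- A–B compactness: a subsequence converges in every `L³(Q(0, R))` to a slab profile `u'`
  obtain ⟨u', p', H', ψ, hψ, -, hwg', hI', hconv, -⟩ :=
    slab_typeI_compactness M u p G hM hsw hwg hbd
  have hI'top : typeIBound (Iio (0 : ℝ) ×ˢ univ) u' p' H' < ⊤ :=
    lt_of_le_of_lt hI' (ENNReal.mul_lt_top (by simp) hM)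
  have hmem' : ∀ R : ℝ, 0 < R → MemLp (uncurry u') 3
      (volume.restrict (parabolicCylinder R (0 : ℝ × EuclideanSpace ℝ (Fin 3)))) :=
    fun R hR => memLp_three_of_slabProfile hwg' hI'top hR
  -- the scales `c_j = exp (σ (ψ j)) → 1`
  have hδψ : Tendsto (fun j : ℕ => 1 / (((ψ j : ℕ) : ℝ) + 1)) atTop (𝓝 0) :=
    (tendsto_one_div_add_atTop_nhds_zero_nat (𝕜 := ℝ)).comp hψ.tendsto_atTop
  have hσ0 : Tendsto (fun j => σ (ψ j)) atTop (𝓝 0) :=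
    squeeze_zero_norm (fun j => (Real.norm_eq_abs _).trans_le (hσ (ψ j))) hδψ
  have hc1 : Tendsto (fun j => Real.exp (σ (ψ j))) atTop (𝓝 1) := by
    have h := (Real.continuous_exp.tendsto 0).comp hσ0
    rwa [Real.exp_zero] at h
  -- the three terms of the split tend to zero along `j`
  have hK₀top : ENNReal.ofReal 2 * ENNReal.ofReal 32 ^ (1 / (3 : ℝ≥0∞).toReal) ≠ ⊤ :=
    ENNReal.mul_ne_top ENNReal.ofReal_ne_top
      (ENNReal.rpow_ne_top_of_nonneg (by norm_num) ENNReal.ofReal_ne_top)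
  have hT1 : Tendsto (fun j => ENNReal.ofReal 2 * ENNReal.ofReal 32 ^ (1 / (3 : ℝ≥0∞).toReal) *
      eLpNorm (uncurry (u (ψ j)) - uncurry u') 3
        (volume.restrict (parabolicCylinder 2 (0 : ℝ × EuclideanSpace ℝ (Fin 3))))) atTop (𝓝 0) := by
    have h := ENNReal.Tendsto.const_mul (hconv 2 two_pos) (Or.inr hK₀top)
    rwa [mul_zero] at h
  have hT2 : Tendsto (fun j => eLpNorm (uncurry (nsRescale (Real.exp (σ (ψ j))) u') - uncurry u') 3
      (volume.restrict (parabolicCylinder 1 (0 : ℝ × EuclideanSpace ℝ (Fin 3))))) atTop (𝓝 0) :=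
    (stub_rlOrbitContinuous u' hmem' 1 one_pos).comp hc1
  have hT3 : Tendsto (fun j => eLpNorm (uncurry (u (ψ j)) - uncurry u') 3
      (volume.restrict (parabolicCylinder 1 (0 : ℝ × EuclideanSpace ℝ (Fin 3))))) atTop (𝓝 0) :=
    hconv 1 one_pos
  have hsum : Tendsto (fun j => ENNReal.ofReal 2 * ENNReal.ofReal 32 ^ (1 / (3 : ℝ≥0∞).toReal) *
      eLpNorm (uncurry (u (ψ j)) - uncurry u') 3
        (volume.restrict (parabolicCylinder 2 (0 : ℝ × EuclideanSpace ℝ (Fin 3)))) +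
      eLpNorm (uncurry (nsRescale (Real.exp (σ (ψ j))) u') - uncurry u') 3
        (volume.restrict (parabolicCylinder 1 (0 : ℝ × EuclideanSpace ℝ (Fin 3)))) +
      eLpNorm (uncurry (u (ψ j)) - uncurry u') 3
        (volume.restrict (parabolicCylinder 1 (0 : ℝ × EuclideanSpace ℝ (Fin 3))))) atTop (𝓝 0) := by
    have h := (hT1.add hT2).add hT3
    rwa [add_zero, add_zero] at h
  -- a large index `j`: the sum is `< ε` and `c_j ∈ (1/2, 2)`
  have hε0 : (0 : ℝ≥0∞) < ENNReal.ofReal ε := ENNReal.ofReal_pos.2 hε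
  have hcI : ∀ᶠ c : ℝ in 𝓝 1, c ∈ Ioo (1 / 2 : ℝ) 2 := Ioo_mem_nhds (by norm_num) (by norm_num)
  obtain ⟨j, hj, hcj⟩ :=
    ((hsum.eventually (eventually_lt_nhds hε0)).and (hc1.eventually hcI)).exists
  -- measurability of the class member `u (ψ j)` and of its rescaling on `Q(0, 1)`
  have hc0 : 0 < Real.exp (σ (ψ j)) := Real.exp_pos _
  have hum : AEStronglyMeasurable (uncurry (u (ψ j)))
      (volume.restrict (parabolicCylinder 1 (0 : ℝ × EuclideanSpace ℝ (Fin 3)))) :=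
    (hwg (ψ j)).locallyIntegrableOn.aestronglyMeasurable.mono_measure
      (Measure.restrict_mono (parabolicCylinder_origin_subset_slab _) le_rfl)
  have hucm : AEStronglyMeasurable (uncurry (nsRescale (Real.exp (σ (ψ j))) (u (ψ j))))
      (volume.restrict (parabolicCylinder 1 (0 : ℝ × EuclideanSpace ℝ (Fin 3)))) := by
    rw [nsRescale_eq_zoom]
    exact (zoom_slabProfile (hsw (ψ j)) (hwg (ψ j)) hc0).2.1.locallyIntegrableOn.aestronglyMeasurable
      |>.mono_measure (Measure.restrict_mono (parabolicCylinder_origin_subset_slab _) le_rfl)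
  -- the split at `j`, and the contradiction
  have hsplit := frOrbitModulus_split hcj hum hucm hmem'
  exact lt_irrefl _ (((hlt (ψ j)).trans_le hsplit).trans hj)

end Summit.NavierStokesRegularity.NavierStokesRegularity.Theorems

end
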